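import Literature.Probability.LatticeModels.IsingPlusEdwardsSokalNPointBox
import Literature.Probability.LatticeModels.CriticalFKIsingConnectionLawsBox
import Literature.Probability.LatticeModels.CriticalCorrWellDefined
import Summits.CriticalPhenomena.Ising3DConformalLimit.Theorems.ArmDressingArmDressingGlueDefs
import HarnessLib

/-!
# Route `ArmDressing`, crux `ArmDressingGlue` (stmt-CriticalPhenomena-15700):
# stub `stub_edwardsSokalIdentity`

Clause (c) of the support `InfiniteVolumeEdwardsSokal` of the route, in the vocabulary of
`ArmDressingArmDressingGlueDefs`: the Edwards–Sokal identity with `+` boundary condition in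
INFINITE volume at `β_c(3)`,
`criticalCorr 3 n x = Pr n (fun j => {x j}) (EVEN n)` — the critical `n`-point spin correlator
`⟨∏ⱼ σ_{xⱼ}⟩⁺_{β_c}` equals the `L → ∞` limit of the wired critical FK-Ising box probabilities that
every index class `{j | xᵢ ↔ xⱼ in Λ_L}` is even.

Proof (Grimmett 2006, Thm. 1.16 / §4.2 with `n` marked points, then `m*(β_c) = 0`):

1. finite volume (`Literature/Probability/LatticeModels/IsingPlusEdwardsSokalNPointBox`):
   `⟨∏ⱼ σ_{xⱼ}⟩⁺_{Λ_L;β_c,0} = φ¹_{Λ_{L+1}}(E_x)` with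
   `E_x = {∀ j, xⱼ ↮ ∂Λ_{L+1} → #{i | xⱼ ↔ xᵢ} even}`
   (`isingExpect_plus_box_spinMonomial_eq_rcMeasure_real`);
2. the Ising side tends to `criticalCorr 3 n x` (`criticalCorr_wellDefined_holds`,
   Friedli–Velenik 2017 Thm. 3.17 with `m*(β_c) = 0`, Aizenman–Duminil-Copin–Sidoravicius 2015);
3. `E_x` and the route's event `EVEN` differ only on `⋃ⱼ {xⱼ ↔ ∂Λ_{L+1}}`
   (`symmDiff_evenLaw_evenOffBoundary_subset`), whose probability is at most
   `∑ⱼ φ¹_{Λ_{L+1}}(xⱼ ↔ ∂Λ_{L+1}) → 0` (`tendsto_rcMeasure_real_siteArm_criticalBeta_box`: the wired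
   arm is a plus magnetisation, which tends to `m*(β_c) = 0`);
4. hence `PrL n _ (EVEN n) (L+1) → criticalCorr 3 n x`, and `Pr = limUnder` is this limit.

Injectivity of `x` is not needed (indices are counted with multiplicity on both sides).

References: G. Grimmett, *The Random-Cluster Model* (2006), Thm. 1.16, §4.2 (4.12)–(4.13),
Prop. (5.11); R. G. Edwards, A. D. Sokal, Phys. Rev. D 38 (1988); M. Aizenman, H. Duminil-Copin,
V. Sidoravicius, Comm. Math. Phys. 334 (2015), Thm. 1.2.
-/

noncomputable section

namespace Summit.CriticalPhenomena.Ising3DConformalLimit.Cruxes.ArmDressingGlue.EdwardsSokalProof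

open Summit.CriticalPhenomena.Ising3DConformalLimit.Cruxes.ArmDressingGlue.Vocab
open scoped Topology BigOperators symmDiff
open Filter MeasureTheory Literature.Probability.LatticeModels Literature.Probability.Percolation
open Literature.Barriers.CriticalPhenomena

/-- **The route's `EVEN` law and the Edwards–Sokal event agree off the boundary arms**: for marked
points `x₀, …, x_{n-1} ∈ Λ_M`, a configuration lying in exactly one of
`{(i ~ j ⇔ xᵢ ↔ xⱼ) ∈ EVEN n}` and `{∀ j, xⱼ ↮ ∂Λ_M → #{i | xⱼ ↔ xᵢ} even}` joins some `xⱼ` to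
`∂Λ_M` (off these arm events no `xⱼ` is joined to `∂Λ_M`, and a pair `u, v ∈ Λ_M` with
`u = xᵢ`, `v = xⱼ` is the pair `xᵢ, xⱼ`). [folklore] -/
theorem symmDiff_evenLaw_evenOffBoundary_subset (M : ℕ) {n : ℕ} (x : Fin n → Site 3)
    (hx : ∀ j, x j ∈ box 3 M) :
    {ω : BondConfig (BoxV 3 M) | (fun i j => ∃ u v : BoxV 3 M, u.1 ∈ ({x i} : Set (Site 3)) ∧
        v.1 ∈ ({x j} : Set (Site 3)) ∧ (openGraph ω).Reachable u v) ∈ EVEN n} ∆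
      {ω | ∀ j, (¬ ∃ y ∈ boxBoundary 3 M, (openGraph ω).Reachable ⟨x j, hx j⟩ y) →
        Even {i | (openGraph ω).Reachable ⟨x j, hx j⟩ ⟨x i, hx i⟩}.ncard} ⊆
      ⋃ j, {ω | ∃ a y : BoxV 3 M, a.1 = x j ∧ y ∈ boxBoundary 3 M ∧ (openGraph ω).Reachable a y} := by
  intro ω hω
  by_contra hBD
  have hnot : ∀ j, ¬ ∃ y ∈ boxBoundary 3 M, (openGraph ω).Reachable ⟨x j, hx j⟩ y := by
    rintro j ⟨y, hy, hjy⟩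
    exact hBD (Set.mem_iUnion.2 ⟨j, ⟨x j, hx j⟩, y, rfl, hy, hjy⟩)
  have hrel : ∀ i j, (∃ u v : BoxV 3 M, u.1 ∈ ({x i} : Set (Site 3)) ∧
      v.1 ∈ ({x j} : Set (Site 3)) ∧ (openGraph ω).Reachable u v) ↔
      (openGraph ω).Reachable ⟨x i, hx i⟩ ⟨x j, hx j⟩ := by
    intro i j
    constructor
    · rintro ⟨u, v, hu, hv, huv⟩
      rw [Set.mem_singleton_iff] at hu hv
      have hu' : u = ⟨x i, hx i⟩ := Subtype.ext hu
      have hv' : v = ⟨x j, hx j⟩ := Subtype.ext hv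
      rw [← hu', ← hv']
      exact huv
    · intro h
      exact ⟨⟨x i, hx i⟩, ⟨x j, hx j⟩, rfl, rfl, h⟩
  have hiff : ω ∈ {ω : BondConfig (BoxV 3 M) | (fun i j => ∃ u v : BoxV 3 M,
        u.1 ∈ ({x i} : Set (Site 3)) ∧ v.1 ∈ ({x j} : Set (Site 3)) ∧
          (openGraph ω).Reachable u v) ∈ EVEN n} ↔
      ω ∈ {ω : BondConfig (BoxV 3 M) | ∀ j, (¬ ∃ y ∈ boxBoundary 3 M,
          (openGraph ω).Reachable ⟨x j, hx j⟩ y) →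
        Even {i | (openGraph ω).Reachable ⟨x j, hx j⟩ ⟨x i, hx i⟩}.ncard} := by
    simp only [Set.mem_setOf_eq, EVEN, hrel]
    exact ⟨fun h j _ => h j, fun h j => h j (hnot j)⟩
  rcases Set.mem_symmDiff.1 hω with ⟨h1, h2⟩ | ⟨h1, h2⟩
  · exact h2 (hiff.1 h1)
  · exact h2 (hiff.2 h1)

/-- **Clause (c) of the support ES** (registered stub `stub_edwardsSokalIdentity` of the skeleton of
`ArmDressingGlue`): the infinite-volume Edwards–Sokal identity with `+` boundary condition at
`β_c(3)`, `⟨∏ⱼ σ_{xⱼ}⟩⁺_{β_c} = Pr n ({xⱼ})ⱼ (EVEN n)` (Grimmett 2006, Thm. 1.16 and §4.2 with `n`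
marked points in finite volume; the boundary arms vanish in the limit because `m*(β_c) = 0`,
Aizenman–Duminil-Copin–Sidoravicius 2015). [cite: Grimmett2006, Thm. 1.16 and §4.2 eqs. (4.12)–(4.13)] -/
theorem stub_edwardsSokalIdentity : EdwardsSokalIdentity := by
  intro n x _
  have hd : (3 : ℕ) ≤ 3 := le_rfl
  have hβ : 0 ≤ criticalBeta 3 := criticalBeta_nonneg 3
  -- the boundary arms of the marked points and their vanishing
  set arm : Fin n → (M : ℕ) → Set (BondConfig (BoxV 3 M)) := fun j M =>
    {ω | ∃ a y : BoxV 3 M, a.1 = x j ∧ y ∈ boxBoundary 3 M ∧ (openGraph ω).Reachable a y}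
    with harm
  have harm0 : ∀ j, Tendsto (fun M : ℕ => (μ M).real (arm j M)) atTop (𝓝 0) := fun j =>
    tendsto_rcMeasure_real_siteArm_criticalBeta_box hd (x j)
  have hsum0 : Tendsto (fun M : ℕ => ∑ j, (μ M).real (arm j M)) atTop (𝓝 0) := by
    have h := tendsto_finsetSum (Finset.univ : Finset (Fin n)) fun j _ => harm0 j
    rwa [Finset.sum_const_zero] at h
  -- the Ising side converges to the critical correlator
  have hIsing : Tendsto (fun L : ℕ =>
      isingExpect (zdGraph 3) (box 3 L) (criticalBeta 3) 0 .plus (spinMonomial x)) atTop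
      (𝓝 (criticalCorr 3 n x)) :=
    criticalCorr_wellDefined_holds hd n x .plus (by simp)
  -- all marked points eventually lie in the box
  obtain ⟨L₀, hL₀⟩ := exists_forall_subset_box (d := 3) (Finset.univ.image x)
  have hxL : ∀ L, L₀ ≤ L → ∀ j, x j ∈ box 3 L := fun L hL j =>
    hL₀ L hL (Finset.mem_image_of_mem x (Finset.mem_univ j))
  -- finite-volume Edwards–Sokal and the comparison of events, for `L ≥ L₀`
  have hcmp : ∀ L, L₀ ≤ L → |PrL n (fun j => {x j}) (EVEN n) (L + 1) -
      isingExpect (zdGraph 3) (box 3 L) (criticalBeta 3) 0 .plus (spinMonomial x)| ≤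
        ∑ j, (μ (L + 1)).real (arm j (L + 1)) := by
    intro L hL
    have hx1 : ∀ j, x j ∈ box 3 (L + 1) := fun j => box_mono 3 (Nat.le_succ L) (hxL L hL j)
    rw [isingExpect_plus_box_spinMonomial_eq_rcMeasure_real (d := 3) (by norm_num) hβ L x hx1]
    change |(μ (L + 1)).real _ - (μ (L + 1)).real _| ≤ _
    calc _ ≤ (μ (L + 1)).real (_ ∆ _) :=
          abs_measureReal_sub_le_measureReal_symmDiff (Set.toFinite _).measurableSet.nullMeasurableSet
            (Set.toFinite _).measurableSet.nullMeasurableSet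
      _ ≤ (μ (L + 1)).real (⋃ j, arm j (L + 1)) :=
          measureReal_mono (symmDiff_evenLaw_evenOffBoundary_subset (L + 1) x hx1) (measure_ne_top _ _)
      _ ≤ ∑ j, (μ (L + 1)).real (arm j (L + 1)) := measureReal_iUnion_fintype_le _
  -- assemble: `PrL (L+1) → criticalCorr`, shift the index, identify the `limUnder`
  have h0 : Tendsto (fun L : ℕ => PrL n (fun j => {x j}) (EVEN n) (L + 1) -
      isingExpect (zdGraph 3) (box 3 L) (criticalBeta 3) 0 .plus (spinMonomial x)) atTop (𝓝 0) := by
    refine squeeze_zero_norm' ?_ (hsum0.comp (tendsto_add_atTop_nat 1))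
    filter_upwards [eventually_ge_atTop L₀] with L hL
    rw [Real.norm_eq_abs]
    exact hcmp L hL
  have h1 : Tendsto (fun L : ℕ => PrL n (fun j => {x j}) (EVEN n) (L + 1)) atTop
      (𝓝 (criticalCorr 3 n x)) := by
    have h := hIsing.add h0
    rw [add_zero] at h
    exact h.congr fun L => by ring
  have h2 : Tendsto (PrL n (fun j => {x j}) (EVEN n)) atTop (𝓝 (criticalCorr 3 n x)) :=
    (tendsto_add_atTop_iff_nat 1).1 h1
  exact (h2.limUnder_eq).symm

end Summit.CriticalPhenomena.Ising3DConformalLimit.Cruxes.ArmDressingGlue.EdwardsSokalProof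

end
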